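import Mathlib
import HarnessLib

/-!
# `NoHeavyLowerTail` (stmt-CriticalPhenomena-4575) — the hair budget of a heavy TRIANGLE of two-port stars

Support file (prover `prim-gen-swap` gen 8; `--supports stmt-CriticalPhenomena-4575`).  No definitions, no named facts, no sorries; Mathlib only.

The level-two OES certificate for three two-port pendant stars on a triangle of relays (seat memo TRIANGLE-PROOF.md §5, CYCLES-CERT.md §6)
uses, in the regime `θ₁ + θ₂ + θ₃ > 2` (`θ_i = b_i c_i` the link probability of star `i`, `b_i, c_i` its two edge probabilities), the
uniform weights `x ≡ 1/2`, which need the "hair budget" `κ₃ = r(b₁)r(b₂)r(c₃) + r(c₁)r(c₂)r(b₃) ≥ 1/2` (`r(β) = β/(1−β)` the odds of a single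
hair; the two products are the two ways the three hairs can hit three distinct ports).  This file proves the elementary real inequality:

* `StarSet.odds_gt_of_gt`, `StarSet.le_odds`, `StarSet.one_le_odds` — monotonicity facts of `β ↦ β/(1−β)`;
* `StarSet.triangle_hair_budget_of_min` — class 3 minimal and `θ₁ + θ₂ + θ₃ > 2` ⇒ `κ₃ ≥ 1`;
* `StarSet.triangle_hair_budget` — the same without the minimality hypothesis.
-/

namespace Summit.CriticalPhenomena.PercolationContinuityZ3.Theorems

namespace StarSet

/-- Odds are increasing: `β < 1`, `0 < w`, `1 − w < β` ⇒ `(1 − w)/w < β/(1 − β)`. [folklore] -/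
theorem odds_gt_of_gt {β w : ℝ} (hβ1 : β < 1) (hw0 : 0 < w) (h : 1 - w < β) :
    (1 - w) / w < β / (1 - β) := by
  rw [div_lt_div_iff₀ hw0 (by linarith)]
  have : (1 - w) * (1 - β) = 1 - w - β + w * β := by ring
  nlinarith [this]

/-- Odds dominate the probability: `β < 1` ⇒ `β ≤ β/(1 − β)`. [folklore] -/
theorem le_odds {β : ℝ} (hβ1 : β < 1) : β ≤ β / (1 - β) := by
  rw [le_div_iff₀ (by linarith)]
  have : β * (1 - β) = β - β * β := by ring
  nlinarith [mul_self_nonneg β]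

/-- `1/2 < β < 1` ⇒ `1 ≤ β/(1 − β)`. [folklore] -/
theorem one_le_odds {β : ℝ} (hβ : 1 / 2 < β) (hβ1 : β < 1) : 1 ≤ β / (1 - β) := by
  rw [le_div_iff₀ (by linarith)]
  linarith

/-- **Hair budget of a heavy triangle, minimal class last.**  Six edge probabilities in `[0,1)`; `θ_i = b_i c_i`; class 3 minimal;
`θ₁ + θ₂ + θ₃ > 2`.  Then `r(b₁)r(b₂)r(c₃) + r(c₁)r(c₂)r(b₃) ≥ 1`. [this file; TRIANGLE-PROOF.md §5 LEMMA] -/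
theorem triangle_hair_budget_of_min (b₁ c₁ b₂ c₂ b₃ c₃ : ℝ)
    (hb₁ : 0 ≤ b₁) (hb₁' : b₁ < 1) (hc₁ : 0 ≤ c₁) (hc₁' : c₁ < 1)
    (hb₂ : 0 ≤ b₂) (hb₂' : b₂ < 1) (hc₂ : 0 ≤ c₂) (hc₂' : c₂ < 1)
    (hb₃ : 0 ≤ b₃) (hb₃' : b₃ < 1) (hc₃ : 0 ≤ c₃) (hc₃' : c₃ < 1)
    (hS : 2 < b₁ * c₁ + b₂ * c₂ + b₃ * c₃) (hmin₁ : b₃ * c₃ ≤ b₁ * c₁) (hmin₂ : b₃ * c₃ ≤ b₂ * c₂) :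
    1 ≤ b₁ / (1 - b₁) * (b₂ / (1 - b₂)) * (c₃ / (1 - c₃)) + c₁ / (1 - c₁) * (c₂ / (1 - c₂)) * (b₃ / (1 - b₃)) := by
  -- basic bounds on the products
  have hθ₁ : b₁ * c₁ < 1 := mul_lt_one_of_nonneg_of_lt_one_left hb₁ hb₁' hc₁'.le
  have hθ₂ : b₂ * c₂ < 1 := mul_lt_one_of_nonneg_of_lt_one_left hb₂ hb₂' hc₂'.le
  have hθ₁b : b₁ * c₁ ≤ b₁ := mul_le_of_le_one_right hb₁ hc₁'.le
  have hθ₁c : b₁ * c₁ ≤ c₁ := mul_le_of_le_one_left hc₁ hb₁'.le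
  have hθ₂b : b₂ * c₂ ≤ b₂ := mul_le_of_le_one_right hb₂ hc₂'.le
  have hθ₂c : b₂ * c₂ ≤ c₂ := mul_le_of_le_one_left hc₂ hb₂'.le
  have hθ₃b : b₃ * c₃ ≤ b₃ := mul_le_of_le_one_right hb₃ hc₃'.le
  have hθ₃c : b₃ * c₃ ≤ c₃ := mul_le_of_le_one_left hc₃ hb₃'.le
  set w := b₃ * c₃ with hw
  have hw0 : 0 < w := by linarith
  -- odds are nonnegative
  have hr : ∀ {x : ℝ}, 0 ≤ x → x < 1 → 0 ≤ x / (1 - x) := fun hx hx' => div_nonneg hx (by linarith)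
  have hrb₁ := hr hb₁ hb₁'
  have hrc₁ := hr hc₁ hc₁'
  have hrb₃ := hr hb₃ hb₃'
  have hrc₃ := hr hc₃ hc₃'
  -- the minimal class's two hairs: r(b₃) + r(c₃) ≥ 2w
  have hbc : 2 * w ≤ b₃ + c₃ := by
    have h1 : 0 ≤ b₃ * (1 - c₃) := mul_nonneg hb₃ (by linarith)
    have h2 : 0 ≤ c₃ * (1 - b₃) := mul_nonneg hc₃ (by linarith)
    have h3 : b₃ * (1 - c₃) + c₃ * (1 - b₃) = b₃ + c₃ - 2 * (b₃ * c₃) := by ring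
    linarith
  have hsum : 2 * w ≤ b₃ / (1 - b₃) + c₃ / (1 - c₃) := by
    have h1 := le_odds hb₃'
    have h2 := le_odds hc₃'
    linarith
  by_cases hcase : w ≤ 1 / 2
  · -- the four edge probabilities of the two big classes exceed `1 − w`
    have hb₁w : 1 - w < b₁ := by linarith
    have hc₁w : 1 - w < c₁ := by linarith
    have hb₂w : 1 - w < b₂ := by linarith
    have hc₂w : 1 - w < c₂ := by linarith
    set q := (1 - w) / w with hq
    have hq1 : 1 ≤ q := by rw [hq, le_div_iff₀ hw0]; linarith
    have hq0 : 0 ≤ q := le_trans zero_le_one hq1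
    have h1 : q < b₁ / (1 - b₁) := odds_gt_of_gt hb₁' hw0 hb₁w
    have h2 : q < b₂ / (1 - b₂) := odds_gt_of_gt hb₂' hw0 hb₂w
    have h3 : q < c₁ / (1 - c₁) := odds_gt_of_gt hc₁' hw0 hc₁w
    have h4 : q < c₂ / (1 - c₂) := odds_gt_of_gt hc₂' hw0 hc₂w
    -- products
    have hA : q * q * (c₃ / (1 - c₃)) ≤ b₁ / (1 - b₁) * (b₂ / (1 - b₂)) * (c₃ / (1 - c₃)) := by
      have hqq : q * q ≤ b₁ / (1 - b₁) * (b₂ / (1 - b₂)) := mul_le_mul h1.le h2.le hq0 hrb₁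
      exact mul_le_mul_of_nonneg_right hqq hrc₃
    have hB : q * q * (b₃ / (1 - b₃)) ≤ c₁ / (1 - c₁) * (c₂ / (1 - c₂)) * (b₃ / (1 - b₃)) := by
      have hqq : q * q ≤ c₁ / (1 - c₁) * (c₂ / (1 - c₂)) := mul_le_mul h3.le h4.le hq0 hrc₁
      exact mul_le_mul_of_nonneg_right hqq hrb₃
    -- `q² · 2w = 2(1−w)·q ≥ 2(1 − w) ≥ 1` for `w ≤ 1/2`
    have hqe : q * w = 1 - w := by
      rw [hq]
      field_simp
    have hqw : 1 ≤ q * q * (2 * w) := by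
      have heq : q * q * (2 * w) = 2 * (1 - w) * q := by
        calc q * q * (2 * w) = 2 * (q * w) * q := by ring
          _ = 2 * (1 - w) * q := by rw [hqe]
      rw [heq]
      have h2w : 0 ≤ 2 * (1 - w) := by linarith
      have := mul_le_mul_of_nonneg_left hq1 h2w
      linarith
    calc (1 : ℝ) ≤ q * q * (2 * w) := hqw
      _ ≤ q * q * (b₃ / (1 - b₃) + c₃ / (1 - c₃)) := mul_le_mul_of_nonneg_left hsum (mul_nonneg hq0 hq0)
      _ = q * q * (c₃ / (1 - c₃)) + q * q * (b₃ / (1 - b₃)) := by ring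
      _ ≤ _ := add_le_add hA hB
  · -- `w > 1/2`: all six edge probabilities exceed `1/2`, all odds are at least `1`
    push Not at hcase
    have hb₁h : 1 / 2 < b₁ := by linarith
    have hc₁h : 1 / 2 < c₁ := by linarith
    have hb₂h : 1 / 2 < b₂ := by linarith
    have hc₂h : 1 / 2 < c₂ := by linarith
    have h1 := one_le_odds hb₁h hb₁'
    have h2 := one_le_odds hb₂h hb₂'
    have h3 := one_le_odds hc₁h hc₁'
    have h4 := one_le_odds hc₂h hc₂'
    have hA : c₃ / (1 - c₃) ≤ b₁ / (1 - b₁) * (b₂ / (1 - b₂)) * (c₃ / (1 - c₃)) := by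
      have hqq : 1 ≤ b₁ / (1 - b₁) * (b₂ / (1 - b₂)) := one_le_mul_of_one_le_of_one_le h1 h2
      calc c₃ / (1 - c₃) = 1 * (c₃ / (1 - c₃)) := (one_mul _).symm
        _ ≤ _ := mul_le_mul_of_nonneg_right hqq hrc₃
    have hB : b₃ / (1 - b₃) ≤ c₁ / (1 - c₁) * (c₂ / (1 - c₂)) * (b₃ / (1 - b₃)) := by
      have hqq : 1 ≤ c₁ / (1 - c₁) * (c₂ / (1 - c₂)) := one_le_mul_of_one_le_of_one_le h3 h4
      calc b₃ / (1 - b₃) = 1 * (b₃ / (1 - b₃)) := (one_mul _).symm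
        _ ≤ _ := mul_le_mul_of_nonneg_right hqq hrb₃
    linarith

/-- **Hair budget of a heavy triangle.**  Six edge probabilities in `[0,1)`, `θ_i = b_i c_i` with `θ₁ + θ₂ + θ₃ > 2` ⇒ the two-rotation hair budget
`r(b₁)r(b₂)r(c₃) + r(c₁)r(c₂)r(b₃)` is at least `1` (the `x ≡ 1/2` certificate needs `> 1/2`). [this file; TRIANGLE-PROOF.md §5 LEMMA] -/
theorem triangle_hair_budget (b₁ c₁ b₂ c₂ b₃ c₃ : ℝ)
    (hb₁ : 0 ≤ b₁) (hb₁' : b₁ < 1) (hc₁ : 0 ≤ c₁) (hc₁' : c₁ < 1)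
    (hb₂ : 0 ≤ b₂) (hb₂' : b₂ < 1) (hc₂ : 0 ≤ c₂) (hc₂' : c₂ < 1)
    (hb₃ : 0 ≤ b₃) (hb₃' : b₃ < 1) (hc₃ : 0 ≤ c₃) (hc₃' : c₃ < 1)
    (hS : 2 < b₁ * c₁ + b₂ * c₂ + b₃ * c₃) :
    1 ≤ b₁ / (1 - b₁) * (b₂ / (1 - b₂)) * (c₃ / (1 - c₃)) + c₁ / (1 - c₁) * (c₂ / (1 - c₂)) * (b₃ / (1 - b₃)) := by
  have e13 : c₃ * b₃ = b₃ * c₃ := mul_comm _ _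
  have e12 : c₂ * b₂ = b₂ * c₂ := mul_comm _ _
  rcases le_total (b₃ * c₃) (b₁ * c₁) with h31 | h13
  · rcases le_total (b₃ * c₃) (b₂ * c₂) with h32 | h23
    · exact triangle_hair_budget_of_min b₁ c₁ b₂ c₂ b₃ c₃ hb₁ hb₁' hc₁ hc₁' hb₂ hb₂' hc₂ hc₂' hb₃ hb₃' hc₃ hc₃' hS h31 h32
    · -- class 2 minimal: classes (b₁,c₁), (c₃,b₃), (c₂,b₂)
      have h := triangle_hair_budget_of_min b₁ c₁ c₃ b₃ c₂ b₂ hb₁ hb₁' hc₁ hc₁' hc₃ hc₃' hb₃ hb₃' hc₂ hc₂' hb₂ hb₂'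
        (by rw [e13, e12]; linarith) (by rw [e12]; linarith) (by rw [e12, e13]; exact h23)
      calc (1 : ℝ) ≤ _ := h
        _ = _ := by ring
  · rcases le_total (b₁ * c₁) (b₂ * c₂) with h12 | h21
    · -- class 1 minimal: classes (c₂,b₂), (b₃,c₃), (b₁,c₁)
      have h := triangle_hair_budget_of_min c₂ b₂ b₃ c₃ b₁ c₁ hc₂ hc₂' hb₂ hb₂' hb₃ hb₃' hc₃ hc₃' hb₁ hb₁' hc₁ hc₁'
        (by rw [e12]; linarith) (by rw [e12]; exact h12) h13
      calc (1 : ℝ) ≤ _ := h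
        _ = _ := by ring
    · -- class 2 minimal again: θ₂ ≤ θ₁ ≤ θ₃
      have h := triangle_hair_budget_of_min b₁ c₁ c₃ b₃ c₂ b₂ hb₁ hb₁' hc₁ hc₁' hc₃ hc₃' hb₃ hb₃' hc₂ hc₂' hb₂ hb₂'
        (by rw [e13, e12]; linarith) (by rw [e12]; exact h21) (by rw [e12, e13]; linarith)
      calc (1 : ℝ) ≤ _ := h
        _ = _ := by ring

end StarSet

end Summit.CriticalPhenomena.PercolationContinuityZ3.Theorems
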